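import Summits.QuantumFields.YangMills.Theorems.LuscherReductionTwistedTraceScalingBTSchedule
import HarnessLib

/-!
# (B-T) RATES, part 1: the atoms of the schedule tend to zero, and the ELEMENTARY eventual smallness facts
# (lane A of S-BASE, crux `TwistedTraceScaling` stmt-QuantumFields-20203, C4-CORE, the (B-T) pen; design note `pub/ym-fleet/ym-luscher-20007-p1/COARSE-DESIGN.md` §25.9)

Pure real analysis of the schedule of `…BTSchedule` (no measure theory): `eventually_btLog_eq`, `eventually_powScale_eq'`, `eventually_btRad_eq`,
★ `tendsto_powScale_mul_btLog_pow` (`β^{-p}ℓ^k → 0`, `p > 0`), `tendsto_recordDelta1`, `tendsto_btAlpha`, `tendsto_btR1`, `tendsto_btRad`, `tendsto_btEps`,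
`mul_powScale_one` / `mul_powScale_half_sq` (`β·β^{-1} = 1 = β·(β^{-1/2})²` for `β ≥ 1`), and the elementary conjuncts of the smallness hypothesis of
`…BTSchedule.recordBT_hT_of_eventually`: ★ `eventually_small_elementary` (all conjuncts except `ε₁ + ε₂ ≤ 1`) and ★ `eventually_budget_elementary` (`B ≥ 1`, `B ≥ 2/rStar³`,
`2ε/3 < R₁`).  The remaining conjuncts (`ε₁ + ε₂ ≤ 1` and the three exponential budgets (H1)–(H3)) are the `log²β`-versus-`log β` comparisons of part 2.
HONEST FRAMING: a stub of a child of the CONDITIONAL reduction route R2b1; C4-CORE OPEN; not infinite volume, not a gap, not Clay.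
-/

set_option autoImplicit false

noncomputable section

open MeasureTheory Filter Topology Real Asymptotics
open scoped BigOperators
open Literature.MathematicalPhysics.QuantumFieldTheory
open Literature.MathematicalPhysics.QuantumLattice

namespace Summit.QuantumFields.YangMills.Theorems.FemtoTransferGap.TwoLattice.ConstTube

open Summit.QuantumFields.YangMills.Theorems.FemtoTransferGap
open Summit.QuantumFields.YangMills.Theorems.FemtoTransferGap.TwoLattice

variable {L : ℕ} [NeZero L]

/-! ## §1 Atoms -/

omit [NeZero L] in
/-- Eventually `ℓ(β) = log β`. [folklore] -/
theorem eventually_btLog_eq : ∀ᶠ β : ℝ in atTop, btLog β = Real.log β := by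
  filter_upwards [eventually_ge_atTop (Real.exp 1)] with β hβ
  have h : 1 ≤ Real.log β := by rw [← Real.log_exp 1]; exact Real.log_le_log (Real.exp_pos 1) hβ
  exact max_eq_left h

omit [NeZero L] in
/-- Eventually `1 ≤ log β`. [folklore] -/
theorem eventually_one_le_log : ∀ᶠ β : ℝ in atTop, 1 ≤ Real.log β := by
  filter_upwards [eventually_ge_atTop (Real.exp 1)] with β hβ
  rw [← Real.log_exp 1]; exact Real.log_le_log (Real.exp_pos 1) hβ

omit [NeZero L] in
/-- Eventually `powScale p β = β^{-p}`. [folklore] -/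
theorem eventually_powScale_eq' (p : ℝ) : ∀ᶠ β : ℝ in atTop, powScale p β = β ^ (-p) :=
  (eventually_ge_atTop (1 : ℝ)).mono fun _ hβ => powScale_eq hβ

omit [NeZero L] in
/-- ★ `β^{-p}·ℓ(β)^k → 0` for `p > 0`. [folklore] -/
theorem tendsto_powScale_mul_btLog_pow {p : ℝ} (hp : 0 < p) (k : ℕ) : Tendsto (fun β : ℝ => powScale p β * btLog β ^ k) atTop (𝓝 0) := by
  have h := (isLittleO_log_rpow_rpow_atTop (k : ℝ) hp).tendsto_div_nhds_zero
  refine h.congr' ?_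
  filter_upwards [eventually_btLog_eq, eventually_ge_atTop (1 : ℝ)] with β hℓ hβ1
  have hβ0 : 0 < β := by linarith
  rw [hℓ, powScale_eq hβ1, Real.rpow_natCast, Real.rpow_neg hβ0.le, div_eq_mul_inv, mul_comm]

omit [NeZero L] in
/-- `β^{-p} → 0` (`p > 0`), as a special case. [folklore] -/
theorem tendsto_powScale' {p : ℝ} (hp : 0 < p) : Tendsto (fun β : ℝ => powScale p β) atTop (𝓝 0) := tendsto_powScale hp

/-- `δ₁ → 0`. [folklore] -/
theorem tendsto_recordDelta1 {s : ℝ} (hs : 0 < s) : Tendsto (recordDelta1 L s) atTop (𝓝 0) := by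
  have h := ((tendsto_powScale hs).const_mul 14).div_const (Fintype.card (Site 3 L) : ℝ)
  rw [mul_zero, zero_div] at h
  exact h.congr' (Eventually.of_forall fun β => by unfold recordDelta1; ring)

omit [NeZero L] in
/-- `btAlpha → 0`. [folklore] -/
theorem tendsto_btAlpha : Tendsto btAlpha atTop (𝓝 0) := by
  have h := tendsto_powScale_mul_btLog_pow (show (0 : ℝ) < 1 / 2 by norm_num) 1
  simp only [pow_one] at h
  exact h

omit [NeZero L] in
/-- `btR1 → 0`. [folklore] -/
theorem tendsto_btR1 : Tendsto btR1 atTop (𝓝 0) := by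
  have h := (tendsto_powScale_mul_btLog_pow (show (0 : ℝ) < 1 / 2 by norm_num) 1).const_mul 5
  rw [mul_zero] at h
  exact h.congr' (Eventually.of_forall fun β => by unfold btR1; ring)

omit [NeZero L] in
/-- `btEps → 0`. [folklore] -/
theorem tendsto_btEps : Tendsto btEps atTop (𝓝 0) := tendsto_powScale one_pos

omit [NeZero L] in
/-- Eventually `btRad β = β^{-1/2}` (as `powScale`). [folklore] -/
theorem eventually_btRad_eq : ∀ᶠ β : ℝ in atTop, btRad β = powScale (1 / 2) β := by
  filter_upwards [(tendsto_powScale (show (0 : ℝ) < 1 / 2 by norm_num)).eventually (eventually_le_nhds (show (0 : ℝ) < 1 / 40 by norm_num))] with β hβ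
  exact min_eq_right hβ

omit [NeZero L] in
/-- `btRad → 0`. [folklore] -/
theorem tendsto_btRad : Tendsto btRad atTop (𝓝 0) :=
  (tendsto_powScale (show (0 : ℝ) < 1 / 2 by norm_num)).congr' (eventually_btRad_eq.mono fun _ h => h.symm)

omit [NeZero L] in
/-- `β·β^{-1} = 1` for `β ≥ 1`. [folklore] -/
theorem mul_powScale_one {β : ℝ} (hβ : 1 ≤ β) : β * powScale 1 β = 1 := by
  rw [powScale_eq hβ, Real.rpow_neg_one, mul_inv_cancel₀ (by linarith)]

omit [NeZero L] in
/-- `β·(β^{-1/2})² = 1` for `β ≥ 1`. [folklore] -/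
theorem mul_powScale_half_sq {β : ℝ} (hβ : 1 ≤ β) : β * powScale (1 / 2) β ^ 2 = 1 := by
  have hβ0 : 0 ≤ β := by linarith
  rw [powScale_eq hβ, ← Real.rpow_mul_natCast hβ0, show (-(1 / 2 : ℝ)) * ((2 : ℕ) : ℝ) = -1 by norm_num, Real.rpow_neg_one, mul_inv_cancel₀ (by linarith)]

/-! ## §2 The schedule at a large `β`: a bundle of pointwise facts -/

/-- Eventually: `β ≥ 1`, `ℓ = log β ≥ 6`, `r = x := β^{-1/2}`, `ε ≤ x ≤ δ₁/28`, `xℓ < 1/(60L)`, `R₁ < 1/(600L)`, `δ₁ < 1/(4000L)`, `ε < 1/600`, `δ₁ ≤ 1/2`. [folklore] -/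
theorem eventually_schedule_facts {s : ℝ} (hs : 0 < s) (hs2 : s < 1 / 2) :
    ∀ᶠ β : ℝ in atTop, 1 ≤ β ∧ btLog β = Real.log β ∧ 6 ≤ Real.log β ∧ btRad β = powScale (1 / 2) β ∧ btEps β ≤ powScale (1 / 2) β ∧
      powScale (1 / 2) β ≤ recordDelta1 L s β / 28 ∧ powScale (1 / 2) β * Real.log β < 1 / (60 * L) ∧ btR1 β < 1 / (600 * L) ∧
      recordDelta1 L s β < 1 / (4000 * L) ∧ btEps β < 1 / 600 ∧ recordDelta1 L s β ≤ 1 / 2 := by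
  have hL0 : (0 : ℝ) < L := by exact_mod_cast NeZero.pos L
  have hN : (0 : ℝ) < Fintype.card (Site 3 L) := by exact_mod_cast Fintype.card_pos
  have hs2' : (0 : ℝ) < 1 / 2 - s := by linarith
  filter_upwards [eventually_ge_atTop (1 : ℝ), eventually_btLog_eq, eventually_ge_atTop (Real.exp 6), eventually_btRad_eq,
    (tendsto_powScale hs2').eventually (eventually_lt_nhds (show (0 : ℝ) < 1 / (2 * Fintype.card (Site 3 L)) by positivity)),
    (tendsto_powScale_mul_btLog_pow (show (0 : ℝ) < 1 / 2 by norm_num) 1).eventually (eventually_lt_nhds (show (0 : ℝ) < 1 / (60 * L) by positivity)),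
    tendsto_btR1.eventually (eventually_lt_nhds (show (0 : ℝ) < 1 / (600 * L) by positivity)),
    (tendsto_recordDelta1 (L := L) hs).eventually (eventually_lt_nhds (show (0 : ℝ) < 1 / (4000 * L) by positivity)),
    tendsto_btEps.eventually (eventually_lt_nhds (show (0 : ℝ) < 1 / 600 by norm_num)), recordDelta1_le_half (L := L) hs]
    with β hβ1 hℓeq hβ6 hreq hrat hxℓ hR₁ hδs hεs hδhalf
  have hℓ6 : 6 ≤ Real.log β := by rw [← Real.log_exp 6]; exact Real.log_le_log (Real.exp_pos 6) hβ6
  have hεx : btEps β ≤ powScale (1 / 2) β := by unfold btEps; exact powScale_le_powScale (by norm_num) β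
  have hxδ : powScale (1 / 2) β ≤ recordDelta1 L s β / 28 := by
    have e : powScale (1 / 2) β = powScale (1 / 2 - s) β * powScale s β := by
      rw [powScale_eq hβ1, powScale_eq hβ1, powScale_eq hβ1, ← Real.rpow_add (by linarith)]; ring_nf
    rw [e]
    calc powScale (1 / 2 - s) β * powScale s β ≤ 1 / (2 * Fintype.card (Site 3 L)) * powScale s β :=
          mul_le_mul_of_nonneg_right hrat.le (powScale_pos s β).le
      _ = recordDelta1 L s β / 28 := by unfold recordDelta1; field_simp; ring
  rw [pow_one, hℓeq] at hxℓ
  exact ⟨hβ1, hℓeq, hℓ6, hreq, hεx, hxδ, hxℓ, hR₁, hδs, hεs, hδhalf⟩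

/-! ## §3 ★ The elementary smallness conjuncts -/
set_option maxHeartbeats 400000 in
/-- ★ **The elementary conjuncts of the smallness hypothesis**, eventually. [folklore] -/
theorem eventually_small_elementary {s : ℝ} (hs : 0 < s) (hs2 : s < 1 / 2) :
    ∀ᶠ β : ℝ in atTop,
      0 ≤ β ∧ recordDelta1 L s β ≤ 1 / 2 ∧ btAlpha β ≤ 1 ∧ btRad β ≤ 9 * L * btR1 β + btEps β ∧ 9 * L * btR1 β + btEps β ≤ 1 / 30 ∧
      (L : ℝ) ^ 3 * (12 * recordDelta1 L s β ^ 4) < 2 ∧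
      18 * L * (Real.sqrt 2 * btRad β + recordDelta1 L s β) ≤ 1 / 2 ∧
      0 ≤ btR1 β / 2 - 2 * (Real.sqrt 2 * btRad β + recordDelta1 L s β) * btEps β - (2 * Real.sqrt 2 * btRad β + btAlpha β) ∧
      0 ≤ 1 / (3 * L) - 4 * (Real.sqrt 2 * btRad β + recordDelta1 L s β) - (2 * Real.sqrt 2 * btRad β + btAlpha β) ∧
      3 * L * (13 * recordDelta1 L s β) < 1 ∧
      0 ≤ 13 * recordDelta1 L s β - 4 * (Real.sqrt 2 * btRad β + recordDelta1 L s β) - (2 * Real.sqrt 2 * btRad β + 2 * recordDelta1 L s β) ∧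
      2 * btEps β * Fintype.card (Site 3 L) * recordDelta1 L s β + 2 * btRad β ^ 2 +
          2 * Real.sqrt 2 * Fintype.card (Site 3 L) * (9 * L * (13 * recordDelta1 L s β) + btEps β) * btRad β ≤
        Fintype.card (Site 3 L) * (1 - 3 * L * (13 * recordDelta1 L s β)) * btAlpha β := by
  have hL1 : (1 : ℝ) ≤ L := by exact_mod_cast NeZero.one_le
  have hL0 : (0 : ℝ) < L := by linarith
  have hN1 : (1 : ℝ) ≤ Fintype.card (Site 3 L) := by exact_mod_cast Fintype.card_pos
  have hN : (0 : ℝ) < Fintype.card (Site 3 L) := by linarith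
  have h2 : (0 : ℝ) < Real.sqrt 2 := Real.sqrt_pos.mpr (by norm_num)
  have h22 : Real.sqrt 2 < 2 := by
    have := Real.sqrt_lt_sqrt (by norm_num : (0 : ℝ) ≤ 2) (show (2 : ℝ) < 4 by norm_num)
    rwa [show (4 : ℝ) = 2 ^ 2 by norm_num, Real.sqrt_sq (by norm_num : (0 : ℝ) ≤ 2)] at this
  filter_upwards [eventually_schedule_facts (L := L) hs hs2] with β hf
  obtain ⟨hβ1, hℓeq, hℓ6, hreq, hεx, hxδ, hxℓ, hR₁s, hδs, hεs, hδhalf⟩ := hf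
  set x := powScale (1 / 2) β with hxdef
  set δ := recordDelta1 L s β with hδdef
  have hx0 : 0 < x := powScale_pos _ _
  have hδ0 : 0 ≤ δ := by rw [hδdef]; unfold recordDelta1; exact div_nonneg (mul_nonneg (by norm_num) (powScale_pos _ _).le) hN.le
  have hε0 : 0 < btEps β := powScale_pos _ _
  have hαeq : btAlpha β = x * Real.log β := by unfold btAlpha; rw [hℓeq]
  have hR₁eq : btR1 β = 5 * x * Real.log β := by unfold btR1; rw [hℓeq]
  have hLδ : (L : ℝ) * δ < 1 / 4000 := by
    have := mul_lt_mul_of_pos_left hδs hL0; rwa [show (L : ℝ) * (1 / (4000 * L)) = 1 / 4000 by field_simp] at this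
  have hδ4000 : δ < 1 / 4000 := lt_of_le_of_lt (le_mul_of_one_le_left hδ0 hL1) hLδ
  refine ⟨by linarith, hδhalf, ?_, ?_, ?_, ?_, ?_, ?_, ?_, ?_, ?_, ?_⟩
  · -- `α ≤ 1`
    rw [hαeq]; have : (1 : ℝ) / (60 * L) ≤ 1 := by rw [div_le_one (by positivity)]; linarith
    linarith
  · -- `r ≤ 9L R₁ + ε`
    rw [hreq, hR₁eq]
    have h1 : x ≤ x * Real.log β := le_mul_of_one_le_right hx0.le (by linarith)
    have h3 : x * Real.log β ≤ L * (x * Real.log β) := le_mul_of_one_le_left (by positivity) hL1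
    nlinarith
  · -- `9L R₁ + ε ≤ 1/30`
    have : 9 * (L : ℝ) * btR1 β < 9 * L * (1 / (600 * L)) := mul_lt_mul_of_pos_left hR₁s (by positivity)
    rw [show 9 * (L : ℝ) * (1 / (600 * L)) = 3 / 200 by field_simp; ring] at this
    linarith
  · -- `12 L³ δ⁴ < 2`
    have h3 : ((L : ℝ) * δ) ^ 3 ≤ (1 / 4000) ^ 3 := pow_le_pow_left₀ (by positivity) hLδ.le 3
    calc (L : ℝ) ^ 3 * (12 * δ ^ 4) = 12 * (((L : ℝ) * δ) ^ 3 * δ) := by ring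
      _ ≤ 12 * ((1 / 4000) ^ 3 * (1 / 2)) := by
          refine mul_le_mul_of_nonneg_left (mul_le_mul h3 hδhalf hδ0 (by positivity)) (by norm_num)
      _ < 2 := by norm_num
  · -- `18L(√2 r + δ) ≤ 1/2`: `√2 x ≤ 2x ≤ δ/14`
    rw [hreq]
    have hsx : Real.sqrt 2 * x ≤ 2 * x := mul_le_mul_of_nonneg_right h22.le hx0.le
    have h1 : Real.sqrt 2 * x ≤ δ / 14 := by linarith
    have h3 := mul_le_mul_of_nonneg_left h1 (by positivity : (0 : ℝ) ≤ 18 * L)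
    linarith
  · -- near-tail margin: `2.5xℓ − 2(√2x + δ)ε − 2√2x − xℓ ≥ 0`
    rw [hreq, hR₁eq, hαeq]
    have hsx : Real.sqrt 2 * x ≤ 2 * x := mul_le_mul_of_nonneg_right h22.le hx0.le
    have hδε : δ * btEps β ≤ 1 / 2 * x := mul_le_mul hδhalf hεx hε0.le (by norm_num)
    have hxε : x * btEps β ≤ x * (1 / 600) := mul_le_mul_of_nonneg_left hεs.le hx0.le
    have hsxε : Real.sqrt 2 * x * btEps β ≤ 2 * x * btEps β := mul_le_mul_of_nonneg_right hsx hε0.le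
    have hℓx : x * 6 ≤ x * Real.log β := mul_le_mul_of_nonneg_left hℓ6 hx0.le
    linarith
  · -- very-rough margin
    rw [hreq, hαeq]
    have hsx : Real.sqrt 2 * x ≤ 2 * x := mul_le_mul_of_nonneg_right h22.le hx0.le
    have hx1 : x ≤ x * Real.log β := le_mul_of_one_le_right hx0.le (by linarith)
    have hδ' : δ ≤ 1 / (60 * L) := by
      have : (1 : ℝ) / (4000 * L) ≤ 1 / (60 * L) := by rw [div_le_div_iff_of_pos_left one_pos (by positivity) (by positivity)]; nlinarith
      linarith
    have h13 : (1 : ℝ) / (3 * L) = 20 * (1 / (60 * L)) := by field_simp; ring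
    rw [h13]; linarith
  · -- `39 L δ < 1`
    linarith
  · -- rough margin `7δ − 6√2 x ≥ 0`
    rw [hreq]
    have hsx : Real.sqrt 2 * x ≤ 2 * x := mul_le_mul_of_nonneg_right h22.le hx0.le
    linarith
  · -- far junk below the far signal
    rw [hreq, hαeq]
    have h39 : 3 * (L : ℝ) * (13 * δ) ≤ 1 / 2 := by linarith
    have hRHS : Fintype.card (Site 3 L) * (1 / 2) * (x * Real.log β) ≤ Fintype.card (Site 3 L) * (1 - 3 * L * (13 * δ)) * (x * Real.log β) :=
      mul_le_mul_of_nonneg_right (mul_le_mul_of_nonneg_left (by linarith) hN.le) (by positivity)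
    have t1 : 2 * btEps β * Fintype.card (Site 3 L) * δ ≤ Fintype.card (Site 3 L) * x := by
      have h := mul_le_mul hεx hδhalf hδ0 hx0.le
      have := mul_le_mul_of_nonneg_left h (by positivity : (0 : ℝ) ≤ 2 * Fintype.card (Site 3 L))
      linarith
    have hxle : x ≤ 1 / 2 := by have := (btRad_pos_le β).2; rw [hreq] at this; linarith
    have t2 : 2 * x ^ 2 ≤ x := by nlinarith
    have t3 : 2 * Real.sqrt 2 * Fintype.card (Site 3 L) * (9 * L * (13 * δ) + btEps β) * x ≤ Fintype.card (Site 3 L) * x / 2 := by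
      have hin : 9 * (L : ℝ) * (13 * δ) + btEps β ≤ 117 / 4000 + 1 / 600 := by linarith
      have h1 := mul_le_mul_of_nonneg_left hin (by positivity : (0 : ℝ) ≤ 2 * Real.sqrt 2 * Fintype.card (Site 3 L) * x)
      have h2 := mul_le_mul_of_nonneg_right h22.le (by positivity : (0 : ℝ) ≤ Fintype.card (Site 3 L) * x)
      have hNx : 0 ≤ (Fintype.card (Site 3 L) : ℝ) * x := by positivity
      nlinarith [h1, h2, hNx]
    have hx' : x ≤ Fintype.card (Site 3 L) * x := le_mul_of_one_le_left hx0.le hN1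
    have hℓN : Fintype.card (Site 3 L) * x * 6 ≤ Fintype.card (Site 3 L) * x * Real.log β := mul_le_mul_of_nonneg_left hℓ6 (by positivity)
    linarith

/-- ★ **The elementary conjuncts of the budget hypothesis**, eventually. [folklore] -/
theorem eventually_budget_elementary : ∀ᶠ β : ℝ in atTop, 1 ≤ (L : ℝ) ^ 3 * β ∧ 2 / rStar ^ 3 ≤ (L : ℝ) ^ 3 * β ∧ 2 * (btEps β / 3) < btR1 β := by
  have hL1 : (1 : ℝ) ≤ L := by exact_mod_cast NeZero.one_le
  have hL3 : (1 : ℝ) ≤ (L : ℝ) ^ 3 := one_le_pow₀ hL1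
  filter_upwards [eventually_ge_atTop (max 1 (2 / rStar ^ 3))] with β hβ
  have hβ1 : 1 ≤ β := le_trans (le_max_left _ _) hβ
  have hβ2 : 2 / rStar ^ 3 ≤ β := le_trans (le_max_right _ _) hβ
  have hB : β ≤ (L : ℝ) ^ 3 * β := le_mul_of_one_le_left (by linarith) hL3
  refine ⟨by linarith, by linarith, ?_⟩
  have hεx : btEps β ≤ powScale (1 / 2) β := by unfold btEps; exact powScale_le_powScale (by norm_num) β
  have hx0 : 0 < powScale (1 / 2) β := powScale_pos _ _
  unfold btR1
  nlinarith [mul_le_mul_of_nonneg_left (one_le_btLog β) hx0.le]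

end Summit.QuantumFields.YangMills.Theorems.FemtoTransferGap.TwoLattice.ConstTube

end
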